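/-
Copyright (c) 2026 the pub-hodgecm-mathlib formalisation cell (harness21).  Prover seat hodgecm-mathlib-K2Liu-p05 (g2), 2026-09-04
(Track B «K2-LIT», crux hLiu418 = stmt-HodgeConjecture-24832, organ (L24-a) of socket #24i∕#30i `sig_K2LiuThetaTypeSphericalEigenvalueInert`,
LEAD F0P6-plan (g11) RULING «M-155g» (ii)).
-/
import Literature.NumberTheory.GelbartRogawski1991.LocalSchrodingerFixedVectorsFinite   -- ★ the lattice-model support bound engine `eq_zero_of_inner_toLp_eq_zero_on_finset`
import Literature.NumberTheory.GelbartRogawski1991.FiniteAdelicSplittingAssembly        -- ★ `FinLocalSplittings`, `omegaLoc`, `proj_s`, `isSmooth_omegaLoc`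
import Literature.NumberTheory.Automorphic.FiniteAdeleSchrodingerFactorwise              -- ★ `localSchrodinger_unitVec`
import Literature.NumberTheory.Automorphic.AdmissibleSubquotient                         -- ★ `Representation.map_fixedPoints_eq_of_surjective`
import Literature.NumberTheory.Automorphic.ParabolicInductionAdmissibleProofs            -- ★ `Representation.fixedPoints_comp`, `Representation.IsSmooth.comp`
import Literature.RepresentationTheory.TwistedCoinvariants                               -- ★ `TwistedCoinv.rep`, `TwistedCoinv.mk`
import HarnessLib

/-!
# (L24-a) The `K`-fixed vectors of the local Weil representation `ω_v` on `𝒮(F_vᴺ)` form the LINE `ℂ · 1_{𝒪_vᴺ}` as soon as `K`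
# EXPANDS every vector off the self-dual box — and so do the `K`-fixed classes of every quotient (the local θ-factor)

Topic: crux hLiu418 (stmt-HodgeConjecture-24832), Track B «K2-LIT», socket #24i∕#30i `sig_K2LiuThetaTypeSphericalEigenvalueInert` of
`Cruxes/HLiu418/Lines/K2_Liu_CurveThetaSigs_U5e_InertSeam.lean` (ED. 2), organ (L24-a) «the `K_v`-invariants of the inert local Weil carrier are the
line of `1_{𝒪ᴺ}`» (LEAD F0P6-plan (g11) RULING «M-155g» (ii); words K2Liu-p01 (g3) `INERT-SOCKETS-v2` §3 (Ω5); K2Liu-p04 (g3) (Ω1) CENSUS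
4cec269fce4c3299).  Namespace `Summit.HodgeConjecture.HodgeConjecture.Cruxes.HLiu418.K2LiuInertWeilSphericalLine`.  THEOREMS ONLY (no definition,
no named fact, no instance, no notation, no `sorry`); `--supports stmt-HodgeConjecture-24832 --as helper`; count-neutral.

THE MATHEMATICS ([MoeglinVignerasWaldspurger1987, Chap. 2 II.8; Chap. 5 I.4, I.11 (`S^{K₁×K₂} = ℂ s₀` when the first member is compact)],
[Howe1979, §2]).  Setting of ★ `GelbartRogawski1991/FiniteAdelicSplittingAssembly`: a restricted family `𝓢` of local splittings
`s_v : U(J)(F_v) →* S̃p_{ψ_v}(𝕎_v)` over `ι_v`, `ω_v = toRep ∘ s_v` on `𝒮(F_vᴺ)`, `𝕎_v = F_vᴺ × F_vᴺ` with `B = polar β_{𝕋_v}`, `ψ_v = adeleAddCharAt F v`,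
`φ₀ = 1_{𝒪_vᴺ}` (★ `unitVec`), and the SELF-DUAL BOX `Λ₀ = 𝒪_vᴺ × 𝒪_vᴺ` (`piPrimePowBall 0 ×ˢ piPrimePowBall 0`).  Say that a subgroup `K ≤ U(J)(F_v)`
**expands off `Λ₀`** if every `w ∉ Λ₀` is moved by some `k ∈ K` by a box vector `ι_v(k) w - w ∈ Λ₀` with NON-TRIVIAL Heisenberg phase
`ψ_v(f_{ι k}(w) - B(w, ι_v(k) w - w)) ≠ 1`.  Then (§1) **every `K`-fixed `f ∈ 𝒮(F_vᴺ)` is a multiple of `φ₀`** provided `K` fixes `φ₀` and `𝕋_v` is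
`v`-integral: the tree's ENGINE ★ `LocalSchrodingerFixedVectorsFinite.eq_zero_of_inner_toLp_eq_zero_on_finset` (the coefficients
`c_f(w) = ⟪[ρ(w,0)φ₀],[f]⟫_{L²}` are invariant under pairs fixing `φ₀` and `f`, vanish wherever `K` expands, and separate by the irreducibility of the unitary
Schrödinger representation) is run with `Ω = Λ = Λ₀` and the single representative `R = {0}`: «`f` `K`-fixed and `⟪[φ₀],[f]⟫ = 0 ⇒ f = 0`», i.e.
`f ↦ ⟪[φ₀],[f]⟫` is injective on `ω_v^K`, applied to `f - (⟪[φ₀],[f]⟫∕⟪[φ₀],[φ₀]⟫) • φ₀`.  (§2) the same line bounds the `K`-fixed classes of ANY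
quotient of a smooth representation (★ `Representation.map_fixedPoints_eq_of_surjective`, `K` compact): for the local θ-factor
`Θ_v = TwistedCoinv.rep χ_v ω_v _` (the `χ_v`-coinvariants under the centre) `Θ_v^K ≤ ℂ · [φ₀]`, also after pull-back along a homomorphism
(`Representation.fixedPoints_comp`).  Neither the centre `U(W)(F_v)` nor `χ_v` is used: `ω_v^{K}` itself is the line.
The expansion hypothesis is the SHARP twin (`Ω = Λ₀`, `K` hyperspecial) of ★ `UnitaryGroup.exists_expansion_of_isField` (`Ω` a large box, `K` small);
it is discharged from the isotropic ROOT ELEMENTS of ★ `UnitaryGroupIsotropicRootSymplectic` in the sequel `K2LiuInertWeilSphericalLineOfRoots.lean`.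

HONEST LABEL: HC_CM is proved only modulo the 7 printed citations (2 remaining named inputs: hLiu418 = stmt-HodgeConjecture-24832, h413 =
stmt-HodgeConjecture-24833) until rung 0 closes; this file is a count-neutral helper toward #24i and closes nothing.

## References
* [MoeglinVignerasWaldspurger1987] C. Mœglin, M.-F. Vignéras, J.-L. Waldspurger, *Correspondances de Howe sur un corps p-adique*, LNM 1291 (1987),
  Chap. 2 II.8 (lattice model), Chap. 5 I.4, I.10–I.11 (unramified correspondence, the spherical line).
* [Howe1979] R. Howe, *θ-series and invariant theory*, Proc. Symp. Pure Math. 33.1 (1979) 275–285, §2.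
* [GelbartRogawski1991] S. Gelbart, J. Rogawski, Invent. Math. 105 (1991), §3.1 (3.1.3) p. 456 (the unramified vector).
* [Liu2021] Y. Liu, Camb. J. Math. 9 (2021), App. D Lem. D.1 (l. 5226–5233).
-/

set_option autoImplicit false
set_option linter.dupNamespace false

noncomputable section

open NumberField IsDedekindDomain MeasureTheory
open scoped InnerProductSpace Matrix
open Literature.RepresentationTheory.HeisenbergGroup
open Literature.NumberTheory.Automorphic
open Literature.NumberTheory.GelbartRogawski1991.UnitaryDualPair.LocalSplitting

namespace Summit.HodgeConjecture.HodgeConjecture.Cruxes.HLiu418.K2LiuInertWeilSphericalLine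

/-! ## §1 The engine run with `Ω = Λ = Λ₀`, `R = {0}`: `ω_v^K = ℂ · 1_{𝒪_vᴺ}` from expansion off the self-dual box -/

section Line

variable {F : Type} [Field F] [NumberField F] {E : Type} [Field E] [NumberField E] [Algebra F E]
  [Algebra.IsQuadraticExtension F E] {c : E ≃ₐ[F] E} {N : ℕ} {δ : E} {hcδ : c δ = -δ} {hδ : δ ≠ 0} {d : F}
  {hd : δ * δ = algebraMap F E d} {T : Matrix (Fin N) (Fin N) F} {hT : T.IsSymm}
  {J : Matrix (Fin N) (Fin N) E} {hJ : J = T.map (algebraMap F E)}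
  (𝓢 : FinLocalSplittings F E c N hcδ hδ hd T hT hJ) (v : HeightOneSpectrum (𝓞 F))

/-- `1_{𝒪_vᴺ} ≠ 0` (its value at `0` is `1`). [cite: GelbartRogawski1991, §3.1 (3.1.3) p. 456] -/
theorem unitVec_ne_zero : unitVec F (Fin N) v ≠ 0 := by
  intro h0
  have h1 := unitVec_apply_of_mem (zero_mem_integralBox F (Fin N) v)
  rw [h0] at h1
  exact one_ne_zero (h1.symm.trans rfl)

/-- the Heisenberg translations by the self-dual box `Λ₀ = 𝒪_vᴺ × 𝒪_vᴺ` fix `1_{𝒪_vᴺ}` when `𝕋_v` is `v`-integral (`ψ_v` is trivial on `𝒪_v`).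
[cite: MoeglinVignerasWaldspurger1987, Chap. 2 II.8] -/
theorem localSchrodinger_box_unitVec (hTi : ∀ i j, localGram F N T v i j ∈ primePowBall (v.adicCompletion F) 0)
    (a : (Fin N → v.adicCompletion F) × (Fin N → v.adicCompletion F))
    (ha : a ∈ piPrimePowBall (v.adicCompletion F) (Fin N) 0 ×ˢ piPrimePowBall (v.adicCompletion F) (Fin N) 0) :
    localSchrodinger F N T v ⟨a, 0⟩ (unitVec F (Fin N) v) = unitVec F (Fin N) v := by
  obtain ⟨x, y⟩ := a
  obtain ⟨hx, hy⟩ := ha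
  refine localSchrodinger_unitVec T v (fun i => ?_) (fun i => ?_)
  · rw [← mem_primePowBall_zero_iff]
    exact (mem_piPrimePowBall_iff).1 hx i
  · rw [← mem_primePowBall_zero_iff, Matrix.mulVec, show (0 : ℤ) = (0 : ℤ) + 0 by ring]
    exact dotProduct_mem_primePowBall ((mem_piPrimePowBall_iff).2 fun l => hTi i l) hy

/-- **(L24-a), MODEL FORM: `ω_v^K ⊆ ℂ · 1_{𝒪_vᴺ}` from EXPANSION OFF THE SELF-DUAL BOX.**  Let `𝓢` be a family of local splittings over `ι_v`,
`det T` a unit, `𝕋_v` `v`-integral, and `K ≤ U(J)(F_v)` a subgroup fixing `φ₀ = 1_{𝒪_vᴺ}` under `ω_v` such that every `w ∉ Λ₀ = 𝒪_vᴺ × 𝒪_vᴺ` is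
moved by some `k ∈ K` by a vector `ι_v(k) w - w ∈ Λ₀` with `ψ_v(f_{ι k}(w) - B(w, ι_v(k)w - w)) ≠ 1`.  Then every `K`-fixed `f ∈ 𝒮(F_vᴺ)` is
`a • 1_{𝒪_vᴺ}` with `a = ⟪[φ₀],[f]⟫ ∕ ⟪[φ₀],[φ₀]⟫` — the engine ★ `eq_zero_of_inner_toLp_eq_zero_on_finset` with `Ω = Λ = Λ₀`, `R = {0}` applied to
`f - a • φ₀`. [cite: MoeglinVignerasWaldspurger1987, Chap. 2 II.8; Chap. 5 I.11] [cite: Howe1979, §2] -/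
theorem omegaLoc_fixed_eq_smul_unitVec_of_expansion (hTd : IsUnit T.det)
    (hTi : ∀ i j, localGram F N T v i j ∈ primePowBall (v.adicCompletion F) 0)
    (K : Subgroup (UnitaryGroup.localPi E c N J v))
    (hKφ : ∀ k ∈ K, 𝓢.omegaLoc v k (unitVec F (Fin N) v) = unitVec F (Fin N) v)
    (hexp : ∀ w : (Fin N → v.adicCompletion F) × (Fin N → v.adicCompletion F),
      w ∉ piPrimePowBall (v.adicCompletion F) (Fin N) 0 ×ˢ piPrimePowBall (v.adicCompletion F) (Fin N) 0 →
      ∃ k ∈ K, ((iota F E c N hcδ hδ hd T hT hJ v k).1 w - w) ∈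
          piPrimePowBall (v.adicCompletion F) (Fin N) 0 ×ˢ piPrimePowBall (v.adicCompletion F) (Fin N) 0 ∧
        adeleAddCharAt F v ((ofSymplectic (polar (localPairing F N T v)) (iota F E c N hcδ hδ hd T hT hJ v k)).f w -
          polar (localPairing F N T v) w ((iota F E c N hcδ hδ hd T hT hJ v k).1 w - w)) ≠ 1)
    (f : SchwartzBruhat (Fin N → v.adicCompletion F)) (hf : ∀ k ∈ K, 𝓢.omegaLoc v k f = f) :
    ∃ a : ℂ, f = a • unitVec F (Fin N) v := by
  classical
  letI : MeasurableSpace (v.adicCompletion F) := borel _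
  haveI : BorelSpace (v.adicCompletion F) := ⟨rfl⟩
  haveI := secondCountableTopology_adicCompletion F v
  obtain ⟨μ', hμ'⟩ : ∃ μ' : Measure (v.adicCompletion F), μ' = Measure.addHaar := ⟨_, rfl⟩
  haveI : μ'.IsAddHaarMeasure := hμ' ▸ inferInstance
  have hφ₀ : unitVec F (Fin N) v ≠ 0 := unitVec_ne_zero v
  -- the coefficient against `φ₀` itself and the scalar `a`
  have h00 : ⟪SchwartzBruhat.toLp (Measure.pi fun _ : Fin N => μ') (unitVec F (Fin N) v),
      SchwartzBruhat.toLp (Measure.pi fun _ : Fin N => μ') (unitVec F (Fin N) v)⟫_ℂ ≠ 0 := by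
    intro h0
    have h1 : SchwartzBruhat.toLp (Measure.pi fun _ : Fin N => μ') (unitVec F (Fin N) v) = 0 := inner_self_eq_zero.1 h0
    rw [SchwartzBruhat.toLp_eq_zero_iff] at h1
    exact hφ₀ h1
  refine ⟨⟪SchwartzBruhat.toLp (Measure.pi fun _ : Fin N => μ') (unitVec F (Fin N) v),
      SchwartzBruhat.toLp (Measure.pi fun _ : Fin N => μ') f⟫_ℂ /
    ⟪SchwartzBruhat.toLp (Measure.pi fun _ : Fin N => μ') (unitVec F (Fin N) v),
      SchwartzBruhat.toLp (Measure.pi fun _ : Fin N => μ') (unitVec F (Fin N) v)⟫_ℂ, ?_⟩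
  generalize ha : ⟪SchwartzBruhat.toLp (Measure.pi fun _ : Fin N => μ') (unitVec F (Fin N) v),
      SchwartzBruhat.toLp (Measure.pi fun _ : Fin N => μ') f⟫_ℂ /
    ⟪SchwartzBruhat.toLp (Measure.pi fun _ : Fin N => μ') (unitVec F (Fin N) v),
      SchwartzBruhat.toLp (Measure.pi fun _ : Fin N => μ') (unitVec F (Fin N) v)⟫_ℂ = a
  -- `f - a • φ₀` is `K`-fixed
  have hfix : ∀ k ∈ K, MpPsi.toRep (localSchrodinger F N T v) (𝓢.s v k) (f - a • unitVec F (Fin N) v) =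
      f - a • unitVec F (Fin N) v := fun k hk => by
    rw [map_sub, map_smul]
    exact congrArg₂ (fun p q => p - a • q) (hf k hk) (hKφ k hk)
  -- the box fixes `φ₀`, the single representative `0`, and the expansion hypothesis read through `π ∘ s_v = ι_v`
  have hΛ := localSchrodinger_box_unitVec v hTi
  have hR : ∀ w ∈ piPrimePowBall (v.adicCompletion F) (Fin N) 0 ×ˢ piPrimePowBall (v.adicCompletion F) (Fin N) 0,
      ∃ r ∈ ({0} : Finset ((Fin N → v.adicCompletion F) × (Fin N → v.adicCompletion F))), w - r ∈
        piPrimePowBall (v.adicCompletion F) (Fin N) 0 ×ˢ piPrimePowBall (v.adicCompletion F) (Fin N) 0 :=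
    fun w hw => ⟨0, Finset.mem_singleton_self _, by rwa [sub_zero]⟩
  have hexp' : ∀ w : (Fin N → v.adicCompletion F) × (Fin N → v.adicCompletion F),
      w ∉ piPrimePowBall (v.adicCompletion F) (Fin N) 0 ×ˢ piPrimePowBall (v.adicCompletion F) (Fin N) 0 →
      ∃ k ∈ K, ((MpPsi.proj _ (𝓢.s v k)).1 w - w) ∈
          piPrimePowBall (v.adicCompletion F) (Fin N) 0 ×ˢ piPrimePowBall (v.adicCompletion F) (Fin N) 0 ∧
        adeleAddCharAt F v ((ofSymplectic (polar (localPairing F N T v)) (MpPsi.proj _ (𝓢.s v k))).f w -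
          polar (localPairing F N T v) w ((MpPsi.proj _ (𝓢.s v k)).1 w - w)) ≠ 1 :=
    fun w hw => (hexp w hw).imp fun k hk => ⟨hk.1, by rw [𝓢.proj_s v k]; exact hk.2⟩
  -- the coefficient of `f - a • φ₀` at the representative `0` vanishes by the choice of `a`
  have hfR : ∀ r ∈ ({0} : Finset ((Fin N → v.adicCompletion F) × (Fin N → v.adicCompletion F))),
      ⟪SchwartzBruhat.toLp (Measure.pi fun _ : Fin N => μ') (localSchrodinger F N T v ⟨r, 0⟩ (unitVec F (Fin N) v)),
        SchwartzBruhat.toLp (Measure.pi fun _ : Fin N => μ') (f - a • unitVec F (Fin N) v)⟫_ℂ = 0 := by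
    intro r hr
    rw [Finset.mem_singleton] at hr
    subst hr
    rw [hΛ 0 ⟨zero_mem_piPrimePowBall _, zero_mem_piPrimePowBall _⟩, map_sub, map_smul, inner_sub_right, inner_smul_right,
      ← ha, div_mul_cancel₀ _ h00, sub_self]
  have hzero := eq_zero_of_inner_toLp_eq_zero_on_finset μ' hTd (𝓢.s v) K hφ₀ hKφ hΛ hexp' hR hfix hfR
  exact (sub_eq_zero.1 hzero)

/-- **(L24-a), SUBMODULE FORM: `ω_v^K = ℂ ∙ 1_{𝒪_vᴺ}`** under the hypotheses of `omegaLoc_fixed_eq_smul_unitVec_of_expansion` (the line is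
attained: `K` fixes `1_{𝒪_vᴺ}`). [cite: MoeglinVignerasWaldspurger1987, Chap. 5 I.11] [cite: Howe1979, §2] -/
theorem fixedPoints_omegaLoc_eq_span_unitVec_of_expansion (hTd : IsUnit T.det)
    (hTi : ∀ i j, localGram F N T v i j ∈ primePowBall (v.adicCompletion F) 0)
    (K : Subgroup (UnitaryGroup.localPi E c N J v))
    (hKφ : ∀ k ∈ K, 𝓢.omegaLoc v k (unitVec F (Fin N) v) = unitVec F (Fin N) v)
    (hexp : ∀ w : (Fin N → v.adicCompletion F) × (Fin N → v.adicCompletion F),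
      w ∉ piPrimePowBall (v.adicCompletion F) (Fin N) 0 ×ˢ piPrimePowBall (v.adicCompletion F) (Fin N) 0 →
      ∃ k ∈ K, ((iota F E c N hcδ hδ hd T hT hJ v k).1 w - w) ∈
          piPrimePowBall (v.adicCompletion F) (Fin N) 0 ×ˢ piPrimePowBall (v.adicCompletion F) (Fin N) 0 ∧
        adeleAddCharAt F v ((ofSymplectic (polar (localPairing F N T v)) (iota F E c N hcδ hδ hd T hT hJ v k)).f w -
          polar (localPairing F N T v) w ((iota F E c N hcδ hδ hd T hT hJ v k).1 w - w)) ≠ 1) :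
    (𝓢.omegaLoc v).fixedPoints K = ℂ ∙ unitVec F (Fin N) v := by
  refine le_antisymm (fun f hf => ?_) ?_
  · obtain ⟨a, ha⟩ := omegaLoc_fixed_eq_smul_unitVec_of_expansion 𝓢 v hTd hTi K hKφ hexp f
      (fun k hk => ((𝓢.omegaLoc v).mem_fixedPoints K f).1 hf k hk)
    rw [ha]
    exact Submodule.smul_mem _ a (Submodule.mem_span_singleton_self _)
  · rw [Submodule.span_le, Set.singleton_subset_iff, SetLike.mem_coe]
    exact ((𝓢.omegaLoc v).mem_fixedPoints K _).2 hKφ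

end Line

/-! ## §2 Quotients and pull-backs: the `K`-fixed classes of the local θ-factor lie on the line of `[1_{𝒪_vᴺ}]` -/

section Quotient

variable {k G H V W : Type*} [Field k] [CharZero k] [Group G] [TopologicalSpace G] [IsTopologicalGroup G] [Group H]
  [AddCommGroup V] [Module k V] [AddCommGroup W] [Module k W]

/-- **fixed lines pass to quotients**: for a SMOOTH `ρ`, a compact `K` and a surjective intertwiner `q : ρ → τ`, `ρ^K ≤ k ∙ φ₀` implies
`τ^K ≤ k ∙ q φ₀` (`τ^K = q(ρ^K)` by averaging over `K`, ★ `Representation.map_fixedPoints_eq_of_surjective`).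
[cite: MoeglinVignerasWaldspurger1987, Chap. 5 I.11] -/
theorem fixedPoints_le_span_map_of_surjective {ρ : Representation k G V} {τ : Representation k G W} (hρ : ρ.IsSmooth)
    (q : ρ.IntertwiningMap τ) (hq : Function.Surjective q) {K : Subgroup G} (hK : IsCompact (K : Set G)) {φ₀ : V}
    (hle : ρ.fixedPoints K ≤ k ∙ φ₀) : τ.fixedPoints K ≤ k ∙ q φ₀ := by
  rw [← Representation.map_fixedPoints_eq_of_surjective hρ q hq hK]
  refine (Submodule.map_mono hle).trans ?_
  rw [Submodule.map_span, Set.image_singleton]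
  exact le_of_eq rfl

/-- **the `K`-fixed classes of the `χ`-coinvariants lie on the line of `[φ₀]`**: for a smooth `ρV` of `G` on `S` commuting with a representation
`ρW` of `H`, a character `χ` of `H`, and a compact `K ≤ G` with `ρV^K ≤ k ∙ φ₀`, the `K`-fixed vectors of `TwistedCoinv.rep χ ρV _` (the
`χ`-coinvariants `S ⧸ ⟨ρW h v - χ h • v⟩`) lie in `k ∙ [φ₀]`.  For `ρV = ω_v`, `ρW = ω_v ∘ localCenter` this is the local θ-factor of [Liu2021, Def. 4.11].
[cite: MoeglinVignerasWaldspurger1987, Chap. 3 §IV.4, Chap. 5 I.11] [cite: Liu2021, App. D Lem. D.1 (l. 5226–5233)] -/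
theorem fixedPoints_twistedCoinv_le_span {S : Type*} [AddCommGroup S] [Module k S] (ρV : Representation k G S) (hρ : ρV.IsSmooth)
    {ρW : Representation k H S} (χ : H →* kˣ) (hc : ∀ (g : G) (h : H), Commute (ρV g) (ρW h))
    {K : Subgroup G} (hK : IsCompact (K : Set G)) {φ₀ : S} (hle : ρV.fixedPoints K ≤ k ∙ φ₀) :
    (Literature.RepresentationTheory.TwistedCoinv.rep χ ρV hc).fixedPoints K ≤
      k ∙ Literature.RepresentationTheory.TwistedCoinv.mk ρW χ φ₀ :=
  fixedPoints_le_span_map_of_surjective hρ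
    ((Literature.RepresentationTheory.TwistedCoinv.mk ρW χ).intertwiningMap_of_isIntertwiningMap _ _ fun g f =>
      (Literature.RepresentationTheory.TwistedCoinv.rep_mk χ ρV hc g f).symm)
    (Literature.RepresentationTheory.TwistedCoinv.mk_surjective ρW χ) hK hle

omit [CharZero k] [TopologicalSpace G] [IsTopologicalGroup G] in
/-- **pull-back along a homomorphism**: the `K'`-fixed vectors of `σ ∘ φ` are the `φ(K')`-fixed vectors of `σ`; so a line bound for `σ^{φ(K')}`
is a line bound for `(σ ∘ φ)^{K'}` (★ `Representation.fixedPoints_comp`). [cite: MoeglinVignerasWaldspurger1987, Chap. 5 I.11] -/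
theorem fixedPoints_comp_le_span {G' : Type*} [Group G'] (σ : Representation k G W) (φ : G' →* G) (K' : Subgroup G') {y₀ : W}
    (hle : σ.fixedPoints (K'.map φ) ≤ k ∙ y₀) : Representation.fixedPoints (σ.comp φ) K' ≤ k ∙ y₀ := by
  rw [Representation.fixedPoints_comp]
  exact hle

end Quotient

end Summit.HodgeConjecture.HodgeConjecture.Cruxes.HLiu418.K2LiuInertWeilSphericalLine

end
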